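import Summits.Parity.GeneralizedHardyLittlewood.Theorems.GreenTaoLevelTwoGITwoCyclicInverseHeisenbergBracket
import Mathlib.Data.ZMod.Basic
import Mathlib.Topology.Instances.AddCircle.Real

/-!
# Route `GreenTaoLevelTwo`, crux `GITwo` (stmt-Parity-21275), line `birth`, stub `stub_cyclicInverse`:
# bracket arithmetic in `ℤ/Nℤ`, `N` odd (GT08a arXiv §12, proof of Lemma 69: "`{αn} = αn − [αn]`")

Sixty-ninth helper file toward the XL stub `stub_cyclicInverse` (B. Green, T. Tao, *An inverse
theorem for the Gowers `U³(G)` norm*, arXiv:math/0503014, Thm. 68 = PEMS 51 (2008) Thm. 12.8).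
Block E17 (arXiv §12, proof of Lemma 69): "observe that `e(q{ξ·n}) = e(qξn)` if we identify `ℤ/Nℤ`
… with the integers from `−N/2` to `N/2`", "since `{αn} = αn − [αn]` and `{γn} = γn − [γn]`, we
have the identity `q{αn}{γn} = qαγn² − qαn[γn] − qγn[αn] + q[αn][γn]`. The last term is an
integer".  In the tree the bracket `N{ξ·x/N}` is `ZMod.valMinAbs (x ξ)` (files `…BohrLattice` …
`…BracketFormFreq`) while the nilsequence side (`…HeisenbergBracket`) produces `⌊nα + ½⌋`; this
def-free file links the two for `N` odd:

* `valMinAbs_intCast_eq_sub_round` — `valMinAbs (k mod N) = k − N·round(k/N)` (`N` odd);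
* `valMinAbs_div_eq`, `abs_valMinAbs_div_lt` — `valMinAbs(k)/N = k/N − round(k/N) = {k/N}`,
  `|{·}| < ½`;  `round_eq_floor_add_half` — `round t = ⌊t + ½⌋`;
* `toAddCircle_eq_coe_valMinAbs_div` — `toAddCircle y = ↑(valMinAbs y / N)` (any `N ≥ 1`);
* `toCircle_bracket_split` — `e(q(A − k)(B − k')) = e(qAB − qAk' − qBk)` for `q, k, k' ∈ ℤ`.

References: [GreenTao2008U3Inverse] arXiv:math/0503014, §12, proof of Lemma 69.
-/

noncomputable section

namespace Summit.Parity.GeneralizedHardyLittlewood.GreenTaoLevelTwoGITwoCyclicInverse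

/-- `round t = ⌊t + ½⌋`. [folklore] -/
theorem round_eq_floor_add_half (t : ℝ) : round t = ⌊t + 1 / 2⌋ := round_eq t

/-- `toAddCircle y = ↑(valMinAbs y / N)` in `ℝ/ℤ`. [folklore] -/
theorem toAddCircle_eq_coe_valMinAbs_div {N : ℕ} [NeZero N] (y : ZMod N) :
    ZMod.toAddCircle y = (((y.valMinAbs : ℝ) / N : ℝ) : AddCircle (1 : ℝ)) := by
  conv_lhs => rw [← ZMod.coe_valMinAbs y]
  rw [ZMod.toAddCircle_intCast]

/-- **`valMinAbs (k mod N) = k − N · round(k/N)` for `N` odd** (the nearest-integer representative;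
for odd `N` there are no ties). [cite: GreenTao2008U3Inverse, §12, proof of Lemma 69] -/
theorem valMinAbs_intCast_eq_sub_round {N : ℕ} [NeZero N] (hN : Odd N) (k : ℤ) :
    (((k : ZMod N).valMinAbs : ℤ) : ℝ) = k - N * round ((k : ℝ) / N) := by
  set v : ℤ := (k : ZMod N).valMinAbs with hv
  have hNpos : (0 : ℝ) < N := by exact_mod_cast Nat.pos_of_ne_zero (NeZero.ne N)
  -- `v ≡ k (mod N)`: `v = k - N j`
  have hcong : ((v - k : ℤ) : ZMod N) = 0 := by
    rw [Int.cast_sub, hv, ZMod.coe_valMinAbs, sub_self]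
  rw [ZMod.intCast_zmod_eq_zero_iff_dvd] at hcong
  obtain ⟨j, hj⟩ := hcong
  -- `|v| ≤ (N-1)/2`
  have habs : (2 * |v| : ℤ) ≤ (N : ℤ) - 1 := by
    have h1 : v.natAbs ≤ N / 2 := ZMod.natAbs_valMinAbs_le _
    have h2 : (v.natAbs : ℤ) = |v| := Int.natCast_natAbs v
    obtain ⟨m, hm⟩ := hN
    omega
  have habsR : 2 * |(v : ℝ)| ≤ (N : ℝ) - 1 := by
    rw [← Int.cast_abs]; exact_mod_cast habs
  -- `k/N = -j + v/N` with `|v/N| < 1/2`, so `round (k/N) = -j`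
  have hkR : (k : ℝ) = v - N * j := by
    have : (v : ℝ) - k = N * j := by exact_mod_cast hj
    linarith
  have hround : round ((k : ℝ) / N) = -j := by
    rw [round_eq, Int.floor_eq_iff]
    have e : (k : ℝ) / N = -j + v / N := by rw [hkR]; field_simp; ring
    rw [e]
    have hvN : |(v : ℝ) / N| < 1 / 2 := by
      rw [abs_div, abs_of_pos hNpos, div_lt_iff₀ hNpos]; linarith
    obtain ⟨hl, hu⟩ := abs_lt.1 hvN
    push_cast
    constructor <;> linarith
  rw [hround, hkR]; push_cast; ring

/-- `valMinAbs(k mod N)/N = k/N − round(k/N)` for `N` odd: the signed fractional part `{k/N}`.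
[cite: GreenTao2008U3Inverse, §12, proof of Lemma 69] -/
theorem valMinAbs_div_eq {N : ℕ} [NeZero N] (hN : Odd N) (k : ℤ) :
    (((k : ZMod N).valMinAbs : ℤ) : ℝ) / N = (k : ℝ) / N - round ((k : ℝ) / N) := by
  have hNpos : (0 : ℝ) < N := by exact_mod_cast Nat.pos_of_ne_zero (NeZero.ne N)
  rw [valMinAbs_intCast_eq_sub_round hN k]
  field_simp

/-- `|valMinAbs y / N| < ½` for `N` odd. [folklore] -/
theorem abs_valMinAbs_div_lt {N : ℕ} [NeZero N] (hN : Odd N) (y : ZMod N) :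
    |(y.valMinAbs : ℝ) / N| < 1 / 2 := by
  have hNpos : (0 : ℝ) < N := by exact_mod_cast Nat.pos_of_ne_zero (NeZero.ne N)
  have habs : (2 * |y.valMinAbs| : ℤ) ≤ (N : ℤ) - 1 := by
    have h1 : y.valMinAbs.natAbs ≤ N / 2 := ZMod.natAbs_valMinAbs_le _
    have h2 : (y.valMinAbs.natAbs : ℤ) = |y.valMinAbs| := Int.natCast_natAbs _
    obtain ⟨m, hm⟩ := hN
    omega
  have habsR : 2 * |(y.valMinAbs : ℝ)| ≤ (N : ℝ) - 1 := by
    rw [← Int.cast_abs]; exact_mod_cast habs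
  rw [abs_div, abs_of_pos hNpos, div_lt_iff₀ hNpos]; linarith

/-- `|valMinAbs y / N| ≤ ½` (any `N ≥ 1`). [folklore] -/
theorem abs_valMinAbs_div_le {N : ℕ} [NeZero N] (y : ZMod N) :
    |(y.valMinAbs : ℝ) / N| ≤ 1 / 2 := by
  have hNpos : (0 : ℝ) < N := by exact_mod_cast Nat.pos_of_ne_zero (NeZero.ne N)
  have habs : (2 * |y.valMinAbs| : ℤ) ≤ (N : ℤ) := by
    have h1 : y.valMinAbs.natAbs ≤ N / 2 := ZMod.natAbs_valMinAbs_le _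
    have h2 : (y.valMinAbs.natAbs : ℤ) = |y.valMinAbs| := Int.natCast_natAbs _
    omega
  have habsR : 2 * |(y.valMinAbs : ℝ)| ≤ (N : ℝ) := by
    rw [← Int.cast_abs]; exact_mod_cast habs
  rw [abs_div, abs_of_pos hNpos, div_le_iff₀ hNpos]; linarith

/-- **The bracket splitting identity** (proof of Lemma 69): for `q, k, k' ∈ ℤ` and reals `A, B`,
`e(q(A − k)(B − k')) = e(qAB − qAk' − qBk)` (the term `qkk'` is an integer).  With `A = nα`,
`k = [nα]`, `B = nγ`, `k' = [nγ]`: `e(q{αn}{γn}) = e(qαγn²) e(−qαn[γn]) e(−qγn[αn])`.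
[cite: GreenTao2008U3Inverse, §12, proof of Lemma 69] -/
theorem toCircle_bracket_split (q k k' : ℤ) (A B : ℝ) :
    ((AddCircle.toCircle (((q * (A - k) * (B - k') : ℝ)) : AddCircle (1 : ℝ)) : Circle) : ℂ) =
      ((AddCircle.toCircle (((q * A * B - q * A * k' - q * B * k : ℝ)) : AddCircle (1 : ℝ)) :
        Circle) : ℂ) := by
  have e : (q * (A - k) * (B - k') : ℝ) = (q * A * B - q * A * k' - q * B * k) + ((q * k * k' : ℤ) : ℝ) := by
    push_cast; ring
  rw [e, toCircle_coe_add_int]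

/-- Splitting a real coefficient into its nearest integer and a remainder `|s| ≤ ½`
("Split `a_ξ = q + s`, where `q` is an integer and `|s| ≤ 1/2`"). [cite: GreenTao2008U3Inverse, §12, proof of Lemma 69] -/
theorem exists_int_add_small (a : ℝ) : ∃ (q : ℤ) (s : ℝ), a = q + s ∧ |s| ≤ 1 / 2 :=
  ⟨round a, a - round a, by ring, abs_sub_round a⟩

end Summit.Parity.GeneralizedHardyLittlewood.GreenTaoLevelTwoGITwoCyclicInverse
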